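import Literature.NumberTheory.Automorphic.LocalOrbitalMeasure
import Literature.NumberTheory.Automorphic.LocalOrbitalIntegral
import Literature.LinearAlgebra.Matrix.NonderogatoryCommutant
import Literature.LinearAlgebra.DiagonalizableEigenspaces
import HarnessLib

/-!
# Orbital measure FAMILIES at the classes with commutative centraliser; products of unimodular groups; the commutant of a
regular semisimple matrix (Deitmar–Echterhoff (2014), Thm. 1.5.3; Folland (1995), §2.4; Rogawski (1990), §3.1, §4.9)

Topic `NumberTheory/Automorphic`; namespaces `Literature.LinearAlgebra.Matrix` (§1), `Literature.NumberTheory.Automorphic` (§2).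
THEOREMS ONLY (no definition, no instance, no named fact, no `sorry`).  Generic half of the «regular classes» bridge; the unitary-group
half is `LocalOrbitalMeasureRegular`.

The ★ orbital-measure constructor `exists_smulInvariantMeasure_quotient_centralizer` produces the `G`-invariant measure on `G ⧸ G_γ`
GIVEN an inversion-invariant Haar measure on `G_γ` (`G_γ` unimodular — for every `γ` of a reductive group this is Ranga Rao's theorem,
not in the tree) and UNCONDITIONALLY when `G_γ` is commutative (`…_of_forall_comm`): regular semisimple `γ`.

* §1 `Literature.LinearAlgebra.Matrix.commute_of_charpoly_separable` — over a field, if `χ_A` is separable any two matrices commuting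
  with `A` commute (`A` is nonderogatory, ★ `minpoly_eq_charpoly_of_squarefree_charpoly`, and its commutant is `K[A]`,
  ★ `commute_of_forall_commute_nonderogatory`); `…_pi`: the same over a product of fields (the local algebra `∏_{w∣v} L_w`).
* §2 `modularCharacterFun_eq_one_of_isMulRightInvariant` (one right-invariant Haar measure ⇒ `Δ ≡ 1`); `modularCharacterFun_prod_eq_one`,
  `isMulRightInvariant_prod`, `isInvInvariant_prod` (a product of two unimodular groups is unimodular); `centralizer_prod_comm`;
  and the family constructor
  **`exists_orbitalMeasureFamily_of_forall_comm`**: on a unimodular `G`, for a predicate `P` implying commutativity of the centraliser,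
  an `m : OrbitalMeasureFamily G` (★ `LocalOrbitalIntegral`) whose member at the class of every `P`-representative is `≠ 0`,
  `G`-invariant and regular (finite on compacts) — the three measure properties the local transfer identities are stated with.

## References
* A. Deitmar, S. Echterhoff, *Principles of Harmonic Analysis*, 2nd ed. (2014), Thm. 1.5.3 [DeitmarEchterhoff2014].
* G. B. Folland, *A Course in Abstract Harmonic Analysis* (1995), §2.4 Prop. 2.27 [Folland1995].
* J. Rogawski, *Automorphic Representations of Unitary Groups in Three Variables* (1990), §3.1 p. 19, §4.8 p. 53, §4.9 p. 54 [Rogawski1990].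
* R. A. Horn, C. R. Johnson, *Matrix Analysis*, 2nd ed. (2013), Thm. 3.2.4.2 [HornJohnson2013]; W. Adkins, S. Weintraub, *Algebra* (1992), (4.32).
-/

noncomputable section

open MeasureTheory Measure Polynomial
open Literature.MeasureTheory.Group
open scoped Matrix MatrixGroups NNReal

namespace Literature.LinearAlgebra.Matrix

variable {K : Type*} [Field K] {n : Type*} [Fintype n] [DecidableEq n]

/-! ## §1 Matrices commuting with a regular semisimple matrix commute -/

/-- **Over a field**: if `χ_A` is separable then `A` is nonderogatory (`minpoly = charpoly`, ★ Adkins–Weintraub (4.32)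
`minpoly_eq_charpoly_of_squarefree_charpoly`), so its commutant is `K[A]` (★ Horn–Johnson 3.2.4.2
`commute_of_forall_commute_nonderogatory`) and any two matrices commuting with `A` commute. [cite: Rogawski1990, §3.1 p. 19] -/
theorem commute_of_charpoly_separable (A : Matrix n n K) (hA : A.charpoly.Separable) {B C : Matrix n n K}
    (hB : Commute A B) (hC : Commute A C) : Commute B C := by
  have hmin : minpoly K A = A.charpoly := by
    rw [← Matrix.minpoly_toLin', ← Matrix.charpoly_toLin']
    refine Literature.LinearAlgebra.minpoly_eq_charpoly_of_squarefree_charpoly _ ?_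
    rw [Matrix.charpoly_toLin']
    exact hA.squarefree
  have h : ∀ i : Fin 2, Commute (![B, C] i) A := fun i => by
    fin_cases i
    · exact hB.symm
    · exact hC.symm
  exact commute_of_forall_commute_nonderogatory ![B, C] A hmin h 0 1

/-- **Over a product of fields** (the local algebra `L ⊗ L⁺_v = ∏_{w ∣ v} L_w`, a field at a non-split place, `L_w × L_{w̄}` at a
split one): the same, componentwise. [cite: Rogawski1990, §3.1 p. 19] -/
theorem commute_of_charpoly_separable_pi {ι : Type*} {F : ι → Type*} [∀ i, Field (F i)] (A : Matrix n n (∀ i, F i))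
    (hA : A.charpoly.Separable) {B C : Matrix n n (∀ i, F i)} (hB : Commute A B) (hC : Commute A C) : Commute B C := by
  have hmap : ∀ (i : ι) {D : Matrix n n (∀ i, F i)}, Commute A D →
      Commute (A.map (Pi.evalRingHom F i)) (D.map (Pi.evalRingHom F i)) := fun i D hD => by
    show A.map _ * _ = _ * A.map _
    rw [← Matrix.map_mul, ← Matrix.map_mul, hD.eq]
  have key : ∀ i : ι, (B * C).map (Pi.evalRingHom F i) = (C * B).map (Pi.evalRingHom F i) := fun i => by
    rw [Matrix.map_mul, Matrix.map_mul]
    exact (commute_of_charpoly_separable (A.map (Pi.evalRingHom F i)) (by rw [Matrix.charpoly_map]; exact hA.map)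
      (hmap i hB) (hmap i hC)).eq
  show B * C = C * B
  refine Matrix.ext fun j k => funext fun i => ?_
  have h := Matrix.ext_iff.2 (key i) j k
  rwa [Matrix.map_apply, Matrix.map_apply] at h

end Literature.LinearAlgebra.Matrix

/-! ## §2 Generic locally compact groups: products of unimodular groups; orbital measure FAMILIES at commutative centralisers -/

namespace Literature.NumberTheory.Automorphic

section Generic

variable {G : Type*} [Group G] [TopologicalSpace G] [IsTopologicalGroup G] [LocallyCompactSpace G]
  [SecondCountableTopology G] [MeasurableSpace G] [BorelSpace G]

omit [SecondCountableTopology G] in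
/-- **One right-invariant Haar measure forces `Δ ≡ 1`** (`Δ(g)` is the scalar factor of `map (· * g) μ` against `μ`, Mathlib
`modularCharacterFun_eq_haarScalarFactor`). [cite: Folland1995, §2.4 Prop. 2.27] -/
theorem modularCharacterFun_eq_one_of_isMulRightInvariant (μ : Measure G) [IsHaarMeasure μ] [μ.IsMulRightInvariant] (g : G) :
    modularCharacterFun g = 1 := by
  rw [modularCharacterFun_eq_haarScalarFactor μ]
  simp only [map_mul_right_eq_self μ g, haarScalarFactor_self]

variable {A B : Type*} [Group A] [TopologicalSpace A] [IsTopologicalGroup A] [LocallyCompactSpace A] [SecondCountableTopology A]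
  [Group B] [TopologicalSpace B] [IsTopologicalGroup B] [LocallyCompactSpace B] [SecondCountableTopology B]

/-- **A product of two unimodular groups is unimodular**: `Δ_{A × B} ≡ 1` when `Δ_A ≡ 1` and `Δ_B ≡ 1` (the product of two
right-invariant Haar measures is a right-invariant Haar measure on `A × B`). [cite: Folland1995, §2.4 Prop. 2.27] -/
theorem modularCharacterFun_prod_eq_one (hA : ∀ a : A, modularCharacterFun a = 1) (hB : ∀ b : B, modularCharacterFun b = 1)
    (g : A × B) : modularCharacterFun g = 1 := by
  borelize A B
  haveI : (haar : Measure A).IsMulRightInvariant := isMulRightInvariant_of_modularCharacterFun_eq_one hA _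
  haveI : (haar : Measure B).IsMulRightInvariant := isMulRightInvariant_of_modularCharacterFun_eq_one hB _
  exact modularCharacterFun_eq_one_of_isMulRightInvariant ((haar : Measure A).prod (haar : Measure B)) g

/-- Every Haar measure on the product of two unimodular (second countable, locally compact) groups is right invariant (for any
Borel structure on the product). [cite: Folland1995, §2.4 Prop. 2.27] -/
theorem isMulRightInvariant_prod (hA : ∀ a : A, modularCharacterFun a = 1) (hB : ∀ b : B, modularCharacterFun b = 1)
    [MeasurableSpace (A × B)] [BorelSpace (A × B)] (ν : Measure (A × B)) [IsHaarMeasure ν] : ν.IsMulRightInvariant :=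
  isMulRightInvariant_of_modularCharacterFun_eq_one (modularCharacterFun_prod_eq_one hA hB) ν

/-- Every Haar measure on the product of two unimodular groups is inversion invariant. [cite: Folland1995, §2.4 Prop. 2.27] -/
theorem isInvInvariant_prod (hA : ∀ a : A, modularCharacterFun a = 1) (hB : ∀ b : B, modularCharacterFun b = 1)
    [MeasurableSpace (A × B)] [BorelSpace (A × B)] (ν : Measure (A × B)) [IsHaarMeasure ν] : ν.IsInvInvariant := by
  haveI := isMulRightInvariant_prod hA hB ν
  exact isInvInvariant_of_isMulRightInvariant ν

omit [TopologicalSpace A] [IsTopologicalGroup A] [LocallyCompactSpace A] [SecondCountableTopology A]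
  [TopologicalSpace B] [IsTopologicalGroup B] [LocallyCompactSpace B] [SecondCountableTopology B] in
/-- The centraliser of `(a, b)` in `A × B` is commutative when the centralisers of `a` in `A` and of `b` in `B` are.
[cite: Rogawski1990, §3.1 p. 19] -/
theorem centralizer_prod_comm (a : A) (b : B)
    (ha : ∀ x ∈ Subgroup.centralizer ({a} : Set A), ∀ y ∈ Subgroup.centralizer ({a} : Set A), x * y = y * x)
    (hb : ∀ x ∈ Subgroup.centralizer ({b} : Set B), ∀ y ∈ Subgroup.centralizer ({b} : Set B), x * y = y * x) :
    ∀ x ∈ Subgroup.centralizer ({(a, b)} : Set (A × B)), ∀ y ∈ Subgroup.centralizer ({(a, b)} : Set (A × B)),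
      x * y = y * x := by
  intro x hx y hy
  rw [Subgroup.mem_centralizer_singleton_iff, Prod.ext_iff] at hx hy
  simp only [Prod.fst_mul, Prod.snd_mul] at hx hy
  exact Prod.ext
    (ha _ (Subgroup.mem_centralizer_singleton_iff.2 hx.1) _ (Subgroup.mem_centralizer_singleton_iff.2 hy.1))
    (hb _ (Subgroup.mem_centralizer_singleton_iff.2 hx.2) _ (Subgroup.mem_centralizer_singleton_iff.2 hy.2))

variable [T2Space G]

/-- **A FAMILY of orbital measures at the classes with commutative centraliser** on a unimodular group `G` (`Δ ≡ 1`): for any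
predicate `P` (in applications: regularity) such that the centraliser of every `P`-element is commutative, there is
`m : OrbitalMeasureFamily G` whose member at the class of each `P`-representative `γ_c = out c` is `≠ 0`, `G`-invariant and regular
(★ `exists_smulInvariantMeasure_quotient_centralizer_of_forall_comm` with Haar measures on `G` and on `G_{γ_c}`; the junk member `0`
only at the other classes). [cite: DeitmarEchterhoff2014, Thm. 1.5.3] [cite: Rogawski1990, §4.9 p. 54] -/
theorem exists_orbitalMeasureFamily_of_forall_comm
    [∀ γ : G, MeasurableSpace (G ⧸ Subgroup.centralizer ({γ} : Set G))]
    [∀ γ : G, BorelSpace (G ⧸ Subgroup.centralizer ({γ} : Set G))]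
    (hG : ∀ g : G, modularCharacterFun g = 1) (P : G → Prop)
    (hP : ∀ γ, P γ → ∀ a ∈ Subgroup.centralizer ({γ} : Set G), ∀ b ∈ Subgroup.centralizer ({γ} : Set G), a * b = b * a) :
    ∃ m : OrbitalMeasureFamily G, ∀ c : ConjClasses G, P (Quotient.out c) →
      m c ≠ 0 ∧ SMulInvariantMeasure G (G ⧸ Subgroup.centralizer ({(Quotient.out c : G)} : Set G)) (m c) ∧
        (m c).Regular ∧ IsFiniteMeasureOnCompacts (m c) := by
  classical
  haveI : (haar : Measure G).IsMulRightInvariant := isMulRightInvariant_of_modularCharacterFun_eq_one hG _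
  have hex : ∀ c : ConjClasses G, P (Quotient.out c) →
      ∃ μ : Measure (G ⧸ Subgroup.centralizer ({(Quotient.out c : G)} : Set G)),
        SMulInvariantMeasure G (G ⧸ Subgroup.centralizer ({(Quotient.out c : G)} : Set G)) μ ∧ μ.Regular ∧ μ ≠ 0 := by
    intro c hc
    haveI : LocallyCompactSpace (Subgroup.centralizer ({(Quotient.out c : G)} : Set G)) :=
      (isClosed_coe_centralizer_singleton (Quotient.out c)).isClosedEmbedding_subtypeVal.locallyCompactSpace
    obtain ⟨μ, h1, h2, h3, -⟩ := exists_smulInvariantMeasure_quotient_centralizer_of_forall_comm (Quotient.out c)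
      (hP _ hc) (haar : Measure G) (haar : Measure (Subgroup.centralizer ({(Quotient.out c : G)} : Set G)))
    exact ⟨μ, h1, h2, h3⟩
  refine ⟨fun c => if hc : P (Quotient.out c) then (hex c hc).choose else 0, fun c hc => ?_⟩
  simp only [dif_pos hc]
  obtain ⟨h1, h2, h3⟩ := (hex c hc).choose_spec
  haveI := h2
  exact ⟨h3, h1, h2, inferInstance⟩

end Generic

end Literature.NumberTheory.Automorphic

end
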